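import Literature.AnabelianGeometry.AbsoluteAnabelian.AutHolomorphicSpacesPSL2RLemmas
import Mathlib.Topology.Algebra.Group.Quotient
import Mathlib.Topology.Algebra.ContinuousMonoidHom
import Mathlib.Topology.Maps.Proper.CompactlyGenerated
import HarnessLib

/-!
# `Aut^hol(Y) ≅ SL(2, ℝ)/{±1}` as topological groups (PROOF-ONLY, [AbsTopIII] Prop. 2.2 (ii))

For a Riemann surface `Y` with a biholomorphic homeomorphism `κ : Y ≃ₜ ℍ` and any subgroup `A` of
the self-homeomorphism group of `Y` whose members are exactly the biholomorphic ones (e.g.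
`holAut ⊤`), we construct a topological-group isomorphism
`A ≃ₜ* SL(2, ℝ) ⧸ center` (`exists_continuousMulEquiv_sl`), `A` carrying the topology induced by
the compact-open topology (`homeoCompactOpen`).  Algebra: `AutHolomorphicSpacesPSL2RLemmas`.
Topology: the forward map is continuous because the action `SL(2, ℝ) × ℍ → ℍ` is jointly continuous
(Mathlib) and the compact-open topology is the topology of continuous convergence; the inverse is
continuous because `[g] ↦ (g • i, g • 2i)` is a PROPER injective map `SL(2, ℝ)/{±1} → ℍ × ℍ`
(Mathlib's `isProperMap_smul_I`), hence a closed embedding, through which the evaluation map of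
`A` factors.

[cite: MochizukiAbsTopIII2015, Proposition 2.2 (ii) p.52]
-/

noncomputable section

namespace Literature.AnabelianGeometry.AbsoluteAnabelian

open _root_.TopologicalSpace _root_.Topology _root_.Set _root_.Metric _root_.Function _root_.Filter
open scoped _root_.Manifold _root_.ContDiff ComplexConjugate UpperHalfPlane MatrixGroups
open _root_.UpperHalfPlane Literature.Analysis.Complex

attribute [local instance] homeoCompactOpen

section Topology

variable {Y : Type} [TopologicalSpace Y]

/-- Evaluation at a point is continuous for the compact-open topology on `Y ≃ₜ Y`.
[cite: MochizukiAbsTopIII2015, Proposition 2.2 (ii) p.52] -/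
theorem continuous_homeomorph_eval (y : Y) : Continuous fun ψ : Y ≃ₜ Y => ψ y := by
  show Continuous fun ψ : Y ≃ₜ Y => (ψ : C(Y, Y)) y
  exact (ContinuousEvalConst.continuous_eval_const (F := C(Y, Y)) y).comp continuous_induced_dom

/-- **The conjugated Möbius action is continuous** `SL(2, ℝ) → (Y ≃ₜ Y)` for the compact-open
topology (joint continuity of the action). [cite: MochizukiAbsTopIII2015, Proposition 2.2 (ii) p.52] -/
theorem continuous_conjSmul (κ : Y ≃ₜ ℍ) :
    Continuous fun g : SL(2, ℝ) => κ.trans ((Homeomorph.smul g).trans κ.symm) := by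
  refine continuous_induced_rng.2 ?_
  apply ContinuousMap.continuous_of_continuous_uncurry
  show Continuous fun p : SL(2, ℝ) × Y => κ.symm (p.1 • κ p.2)
  exact κ.symm.continuous.comp (continuous_fst.smul (κ.continuous.comp continuous_snd))

end Topology

section Main

variable {Y : Type} [TopologicalSpace Y] [ChartedSpace ℂ Y]

/-- **[AbsTopIII] Prop. 2.2 (ii), `Aut^hol(X) ≅ SL₂(ℝ)/{±1}` as topological groups**, for any
Riemann surface `Y` biholomorphic to `ℍ` and the subgroup `A` of biholomorphic self-homeomorphisms,
topologised by the compact-open topology. [cite: MochizukiAbsTopIII2015, Proposition 2.2 (ii) p.52] -/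
theorem exists_continuousMulEquiv_sl (κ : Y ≃ₜ ℍ) (hκ : MDifferentiable 𝓘(ℂ, ℂ) 𝓘(ℂ, ℂ) κ)
    (hκs : MDifferentiable 𝓘(ℂ, ℂ) 𝓘(ℂ, ℂ) κ.symm) (A : Subgroup (Y ≃ₜ Y))
    (hA : ∀ ψ, ψ ∈ A ↔ MDifferentiable 𝓘(ℂ, ℂ) 𝓘(ℂ, ℂ) ψ ∧ MDifferentiable 𝓘(ℂ, ℂ) 𝓘(ℂ, ℂ) ψ.symm) :
    ∃ F : (SL(2, ℝ) ⧸ Subgroup.center SL(2, ℝ)) ≃ₜ* A,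
      ∀ g : SL(2, ℝ), ((F (QuotientGroup.mk g) : A) : Y ≃ₜ Y) =
        κ.trans ((Homeomorph.smul g).trans κ.symm) := by
  -- the homomorphism `θ : SL(2, ℝ) → A`
  let θ : SL(2, ℝ) →* (Y ≃ₜ Y) :=
    { toFun := fun g => κ.trans ((Homeomorph.smul g).trans κ.symm)
      map_one' := conjSmul_one κ
      map_mul' := conjSmul_mul κ }
  have hθ : ∀ g, θ g = κ.trans ((Homeomorph.smul g).trans κ.symm) := fun g => rfl
  have hθA : ∀ g, θ g ∈ A := fun g => (hA _).2 (mdifferentiable_conjSmul κ hκ hκs g)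
  let θA : SL(2, ℝ) →* A := θ.codRestrict A hθA
  have hθAval : ∀ g, ((θA g : A) : Y ≃ₜ Y) = κ.trans ((Homeomorph.smul g).trans κ.symm) :=
    fun g => rfl
  have hsurj : Function.Surjective θA := by
    rintro ⟨ψ, hψ⟩
    obtain ⟨g, hg⟩ := exists_conjSmul_eq κ hκ hκs ((hA ψ).1 hψ).1 ((hA ψ).1 hψ).2
    exact ⟨g, Subtype.ext hg⟩
  have hker : ∀ g, θA g = 1 ↔ g ∈ Subgroup.center SL(2, ℝ) := by
    intro g
    rw [← conjSmul_eq_one_iff κ, ← hθAval g]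
    constructor
    · intro h; rw [h]; rfl
    · intro h; exact Subtype.ext h
  set N := Subgroup.center SL(2, ℝ) with hNdef
  have hN : N ≤ θA.ker := fun g hg => (hker g).2 hg
  let L : SL(2, ℝ) ⧸ N →* A := QuotientGroup.lift N θA hN
  have hLmk : ∀ g, L (QuotientGroup.mk g) = θA g := fun g => rfl
  have hLinj : Function.Injective L := by
    intro x y hxy
    induction x using QuotientGroup.induction_on with
    | H g =>
      induction y using QuotientGroup.induction_on with
      | H g' =>
        rw [hLmk, hLmk] at hxy
        apply QuotientGroup.eq.2
        rw [← hker, map_mul, map_inv, hxy, inv_mul_cancel]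
  have hLsurj : Function.Surjective L := fun a => by
    obtain ⟨g, hg⟩ := hsurj a
    exact ⟨QuotientGroup.mk g, by rw [hLmk, hg]⟩
  let E : SL(2, ℝ) ⧸ N ≃* A := MulEquiv.ofBijective L ⟨hLinj, hLsurj⟩
  -- continuity of `L`
  have hθcont : Continuous θA := (continuous_conjSmul κ).subtype_mk _
  have hLcont : Continuous L := by
    rw [(QuotientGroup.isQuotientMap_mk N).continuous_iff]
    have : (⇑L ∘ QuotientGroup.mk) = ⇑θA := funext hLmk
    rw [this]
    exact hθcont
  -- the two-point evaluation and the proper map `g ↦ (g • i, g • 2i)`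
  let I₂ : ℍ := ⟨2 * Complex.I, twoI_im_pos⟩
  let Ev : A → ℍ × ℍ := fun a =>
    (κ ((a : Y ≃ₜ Y) (κ.symm UpperHalfPlane.I)), κ ((a : Y ≃ₜ Y) (κ.symm I₂)))
  have hEv : Continuous Ev := by
    have h1 : Continuous fun a : A => (a : Y ≃ₜ Y) (κ.symm UpperHalfPlane.I) :=
      (continuous_homeomorph_eval _).comp continuous_subtype_val
    have h2 : Continuous fun a : A => (a : Y ≃ₜ Y) (κ.symm I₂) :=
      (continuous_homeomorph_eval _).comp continuous_subtype_val
    exact (κ.continuous.comp h1).prodMk (κ.continuous.comp h2)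
  let q : SL(2, ℝ) → ℍ × ℍ := fun g => (g • UpperHalfPlane.I, g • I₂)
  have hq_cont : Continuous q :=
    (continuous_id.smul continuous_const).prodMk (continuous_id.smul continuous_const)
  have hq_proper : IsProperMap q := by
    rw [isProperMap_iff_isCompact_preimage]
    refine ⟨hq_cont, fun K hK => ?_⟩
    have h1 : IsCompact ((fun g : SL(2, ℝ) => g • UpperHalfPlane.I) ⁻¹' (Prod.fst '' K)) :=
      UpperHalfPlane.isProperMap_smul_I.isCompact_preimage (hK.image continuous_fst)
    exact h1.of_isClosed_subset (hK.isClosed.preimage hq_cont) fun g hg => ⟨q g, hg, rfl⟩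
  have hcomp : Ev ∘ L ∘ QuotientGroup.mk = q := by
    funext g
    simp only [comp_apply, hLmk, Ev, q, hθAval, conjSmul_apply, Homeomorph.apply_symm_apply]
  have hqbar_cont : Continuous (Ev ∘ L) := hEv.comp hLcont
  have hqbar_proper : IsProperMap (Ev ∘ L) :=
    isProperMap_of_comp_of_surj QuotientGroup.continuous_mk hqbar_cont
      (by rw [← Function.comp_assoc] at hcomp; rw [show (Ev ∘ ⇑L) ∘ QuotientGroup.mk = q from hcomp]
          exact hq_proper)
      QuotientGroup.mk_surjective
  have hqbar_inj : Function.Injective (Ev ∘ L) := by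
    intro x y hxy
    induction x using QuotientGroup.induction_on with
    | H g =>
      induction y using QuotientGroup.induction_on with
      | H g' =>
        have hx : (Ev ∘ L) (QuotientGroup.mk g) = q g := congrFun hcomp g
        have hy : (Ev ∘ L) (QuotientGroup.mk g') = q g' := congrFun hcomp g'
        rw [hx, hy] at hxy
        obtain ⟨h1, h2⟩ := Prod.ext_iff.1 hxy
        exact QuotientGroup.eq.2 (smul_I_smul_twoI_inj h1 h2)
  have hqbar_ind : IsInducing (Ev ∘ L) :=
    (IsClosedEmbedding.of_continuous_injective_isClosedMap hqbar_cont hqbar_inj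
      hqbar_proper.isClosedMap).isInducing
  have hLind : IsInducing L := IsInducing.of_comp hLcont hEv hqbar_ind
  let H₀ : SL(2, ℝ) ⧸ N ≃ₜ A := E.toEquiv.toHomeomorphOfIsInducing hLind
  let F : SL(2, ℝ) ⧸ N ≃ₜ* A :=
    { E with continuous_toFun := H₀.continuous, continuous_invFun := H₀.symm.continuous }
  exact ⟨F, fun g => rfl⟩

/-- **[AbsTopIII] Prop. 2.2 (ii), `Aut^hol(X) ≅ SL₂(ℝ)/{±1}`**, `Nonempty` form as in the typed
statement. [cite: MochizukiAbsTopIII2015, Proposition 2.2 (ii) p.52] -/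
theorem nonempty_continuousMulEquiv_sl (κ : Y ≃ₜ ℍ) (hκ : MDifferentiable 𝓘(ℂ, ℂ) 𝓘(ℂ, ℂ) κ)
    (hκs : MDifferentiable 𝓘(ℂ, ℂ) 𝓘(ℂ, ℂ) κ.symm) (A : Subgroup (Y ≃ₜ Y))
    (hA : ∀ ψ, ψ ∈ A ↔ MDifferentiable 𝓘(ℂ, ℂ) 𝓘(ℂ, ℂ) ψ ∧ MDifferentiable 𝓘(ℂ, ℂ) 𝓘(ℂ, ℂ) ψ.symm) :
    Nonempty (A ≃ₜ* (SL(2, ℝ) ⧸ Subgroup.center SL(2, ℝ))) := by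
  obtain ⟨F, -⟩ := exists_continuousMulEquiv_sl κ hκ hκs A hA
  exact ⟨F.symm⟩


end Main

end Literature.AnabelianGeometry.AbsoluteAnabelian
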